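import Literature.NumberTheory.EllipticCurves.EisensteinNewformLevelRaisingInertiaLocalComponentProofs
import Literature.NumberTheory.Automorphic.GL2UnramifiedLFactorDivisibility
import HarnessLib

/-!
# The pole of the new-vector zeta integral divides every JPSS `L`-polynomial of `(π_w, 1)`

Topic `Literature/NumberTheory/EllipticCurves`; proof file (THEOREMS ONLY: no definition, no named
fact, no instance; D-0026), a sibling of the Parts L (`…InertiaNewvectorProofs`) and C
(`…InertiaLocalComponentProofs`) of the road from the Carayol carrier
`Automorphic.galoisRep_GL2_totallyReal_localGlobal` to the local behaviour of the Galois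
representations of newforms.  Parts L and C prove that the `GL₂ × GL₁` zeta integral `Z(s, W, 1)`
of the Whittaker function of a new vector (a `K₁(𝔫)_w`-fixed `U_w`-eigenvector with eigenvalue
`λ ≠ 0`) is NOT a Laurent polynomial in `q^{-s}` — enough for the SHAPE of inertia (Hida 2000,
Thm. 3.26 (3)(a)).  For the VALUE of the Frobenius eigenvalue (Carayol 1986, Thm. (A) in
Euler-factor form) one needs the location of the pole; this file records it:

* `one_sub_C_mul_X_dvd_of_hasRSLFactor_of_newvector` (local, any non-archimedean local field
  `F`): for `W = 𝒲(Λ)(v)` with the new-vector properties of Part L (`ψ` of conductor `𝒪_F`, right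
  invariance under `n(t)`, `|t| ≤ 1`, and `d(u,1)`, `|u| = 1`, the `U`-identity
  `∑_i W(g n(b_i) d(ϖ,1)) = λ W(g)`, and `W(1) ≠ 0`), the zeta integral against the constant
  Whittaker function of `𝟙_{GL₁}` is EXACTLY `c / (1 - α q^{-s})`, `c ≠ 0`,
  `α = (λ / #ι) q^{1/2}` (Part L's `integral_torus_whittaker_eq`, Jacquet–Langlands 1970,
  Prop. 3.5), so clause (a) of `HasRSLFactor` and the comparison lemma
  `dvd_of_eval_mul_eq_const` (`GL2UnramifiedLFactorDivisibility`, JPSS 1983, Thm. 2.7 (ii)) give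
  `(1 - α X) ∣ P` for EVERY JPSS `L`-polynomial `P` of the pair `(π, 𝟙)` and every invariant
  measure (`hasRSLFactor_iff_of_smulInvariant`).
* `exists_newvector_whittakerModel_of_bot`, `exists_newvector_whittakerModel` (global, `K = ℚ`):
  the raw new-vector Whittaker datum of Part C — for a cuspidal `π` on `GL₂(𝔸_ℚ)` with a non-zero
  `K₁(𝔫)`-fixed `U_w`-eigenvector and a local component `π_w` (`HasLocalComponentAt`), a Whittaker
  functional `Λ` of `π_w` for `ψ_w` (the local component of Tate's character, conductor `ℤ_w`) and
  a vector whose Whittaker function has the new-vector properties and does not vanish at `1`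
  (Part C, steps 1–4, verbatim; only the conclusion is the datum instead of its consequence).
* `one_sub_C_mul_X_dvd_of_hasRSLFactor_of_localComponent`: consequently
  `(1 - (λ/ℓ) ℓ^{1/2} X) ∣ P` for every JPSS `L`-polynomial `P` of `(π_w, 𝟙)` w.r.t. `ψ_w`.

## References

* H. Jacquet, R. P. Langlands, *Automorphic forms on GL(2)*, LNM 114 (1970), Prop. 3.5.
  [JacquetLanglands1970]
* H. Jacquet, I. I. Piatetski-Shapiro, J. Shalika, *Rankin–Selberg convolutions*, Amer. J. Math.
  105 (1983), Thm. 2.7 (i)–(ii), (2.4). [JacquetPiatetskiShapiroShalika1983]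
* S. Gelbart, *Automorphic forms on adele groups* (1975), Lemma 3.7. [Gelbart1975]
* H. Carayol, Ann. Sci. ÉNS 19 (1986) 409–468, Thm. (A). [CarayolASENS1986]
-/

noncomputable section

open scoped MatrixGroups NNReal ENNReal Matrix Classical MonoidAlgebra
open MeasureTheory ValuativeRel Polynomial Filter NumberField IsDedekindDomain
  Literature.NumberTheory.GaloisRepresentations.IsNonarchimedeanLocalField
  Literature.NumberTheory.Automorphic

namespace Literature.NumberTheory.EllipticCurves.Hida2000Thm326

/-! ### The local divisibility -/

section Local

variable {F : Type*} [Field F] [ValuativeRel F] [TopologicalSpace F] [IsNonarchimedeanLocalField F]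

/-- **The pole of the new-vector zeta integral divides every JPSS `L`-polynomial of `(π, 𝟙)`.**
Let `π` be a representation of `GL₂(F)` on `V`, `ψ` an additive character of conductor exponent
`0`, `Λ` a `ψ`-Whittaker functional and `v ∈ V` a vector whose Whittaker function `W = 𝒲(Λ)(v)`
is right invariant under `n(t)` (`|t| ≤ 1`) and `d(u, 1)` (`|u| = 1`), satisfies the `U`-identity
`∑_i W(g n(b_i) d(ϖ, 1)) = λ W(g)` (`|b_i| ≤ 1`, `|ϖ| = q⁻¹`) and `W(1) ≠ 0`.  Then for every
`GL₁(F)`-invariant Radon measure `ν` of full support on `GL₁(F) ⧸ U₁` and every polynomial `P`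
with `HasRSLFactor (1<2) π 𝟙 ψ ν P`, `(1 - α X) ∣ P` with `α = (λ / #ι) · q^{1/2}`: the zeta
integral of `(W, 1)` is `μ'(𝒪ˣ) W(1) / (1 - α q^{-s})` for `re s ≫ 0` (Part L,
`integral_torus_whittaker_eq`; Jacquet–Langlands 1970, Prop. 3.5), and clause (a) makes it
`R(q^{-s})/P(q^{-s})` with `R` Laurent (`dvd_of_eval_mul_eq_const`; JPSS 1983, Thm. 2.7 (ii)).
[cite: JacquetLanglands1970, Prop. 3.5] [cite: JacquetPiatetskiShapiroShalika1983, Thm. 2.7 (ii)] -/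
theorem one_sub_C_mul_X_dvd_of_hasRSLFactor_of_newvector
    [MeasurableSpace (GL (Fin 1) F ⧸ upperUnitriangular (Fin 1) F)]
    [BorelSpace (GL (Fin 1) F ⧸ upperUnitriangular (Fin 1) F)]
    {V : Type*} [AddCommGroup V] [Module ℂ V] (π : Representation ℂ (GL (Fin 2) F) V)
    {ψ : AddChar F Circle} (hψ : ψ.HasConductorExp 0) {Λ : Module.Dual ℂ V}
    (hΛ : Λ ∈ whittakerFunctionals π ψ) (v : V)
    (hn : ∀ t : F, normAbs F t ≤ 1 → ∀ g : GL (Fin 2) F,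
      whittakerModel π Λ v (g * ((unipotentGL2 t : ↥(upperUnitriangular (Fin 2) F)) : GL (Fin 2) F)) =
        whittakerModel π Λ v g)
    (hd : ∀ u : Fˣ, normAbs F (u : F) = 1 → ∀ g : GL (Fin 2) F,
      whittakerModel π Λ v (g * diagGL2 u 1) = whittakerModel π Λ v g)
    {ι : Type*} [Fintype ι] [Nonempty ι] {b : ι → F} (hb : ∀ i, normAbs F (b i) ≤ 1) {ϖ : Fˣ}
    (hϖ : normAbs F (ϖ : F) = (residueFieldCard F : ℝ≥0)⁻¹) {lam : ℂ}
    (hU : ∀ g : GL (Fin 2) F,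
      ∑ i, whittakerModel π Λ v (g * (((unipotentGL2 (b i) : ↥(upperUnitriangular (Fin 2) F)) :
        GL (Fin 2) F) * diagGL2 ϖ 1)) = lam * whittakerModel π Λ v g)
    (hW1 : whittakerModel π Λ v 1 ≠ 0)
    (ν : Measure (GL (Fin 1) F ⧸ upperUnitriangular (Fin 1) F))
    [SMulInvariantMeasure (GL (Fin 1) F) (GL (Fin 1) F ⧸ upperUnitriangular (Fin 1) F) ν]
    [IsFiniteMeasureOnCompacts ν] [ν.IsOpenPosMeasure] {P : ℂ[X]}
    (hP : HasRSLFactor Nat.one_lt_two π (Representation.trivial ℂ (GL (Fin 1) F) ℂ) ψ ν P) :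
    (1 - C (lam / Fintype.card ι * ((Real.sqrt (residueFieldCard F) : ℝ) : ℂ)) * X) ∣ P := by
  classical
  letI : MeasurableSpace F := borel F
  haveI : BorelSpace F := ⟨rfl⟩
  haveI : T2Space F :=
    (Literature.NumberTheory.GaloisRepresentations.IsNonarchimedeanLocalField.isLocalField F).toT2Space
  haveI : BorelSpace Fˣ := Units.borelSpace
  -- the measures: `ν₀` transported from a Haar measure `μ'` of `Fˣ`; `HasRSLFactor` is `ν`-independent
  obtain ⟨μ', hμ', ν₀, hinv, hfin, hpos, hint⟩ := exists_haar_measure_quotient_fin_one (F := F)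
  haveI := hμ'
  haveI := hinv
  haveI := hfin
  haveI := hpos
  have hP₀ : HasRSLFactor Nat.one_lt_two π (Representation.trivial ℂ (GL (Fin 1) F) ℂ) ψ ν₀ P :=
    (hasRSLFactor_iff_of_smulInvariant Nat.one_lt_two π _ ψ ν ν₀ P).1 hP
  set q : ℕ := residueFieldCard F with hq_def
  have hq : 1 < q := one_lt_residueFieldCard F
  set ς : ℂ := ((Real.sqrt (residueFieldCard F) : ℝ) : ℂ) with hς_def
  have hς : ς ≠ 0 := sqrt_residueFieldCard_ne_zero
  -- notation and the new-vector properties of `W`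
  set W : GL (Fin 2) F → ℂ := whittakerModel π Λ v with hW_def
  have hN : ∀ (x : F) (g : GL (Fin 2) F),
      W (((unipotentGL2 x : ↥(upperUnitriangular (Fin 2) F)) : GL (Fin 2) F) * g) = ψ x * W g := by
    intro x g
    simp only [hW_def, whittakerModel_apply, map_mul, Module.End.mul_apply]
    rw [(mem_whittakerFunctionals_iff Λ).1 hΛ, whittakerCharFun_fin_two, unipotentGL2_apply_zero_one]
  have hψ1 := addChar_eq_one_of_hasConductorExp_zero hψ
  have hϖ1 : normAbs F (ϖ : F) ≤ 1 := by rw [hϖ]; exact inv_residueFieldCard_lt_one.le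
  set c : ℂ := lam / Fintype.card ι with hc_def
  have h0 : ∀ a : Fˣ, 1 < normAbs F (a : F) → W (diagGL2 a 1) = 0 := fun a ha =>
    whittaker_torus_eq_zero hN hn (exists_addChar_mul_ne_one_of_hasConductorExp_zero hψ) a ha
  have h1 : ∀ (m : ℕ) (u : Fˣ), normAbs F (u : F) = 1 → W (diagGL2 (ϖ ^ m * u) 1) = c ^ m * W 1 := by
    intro m u hu
    rw [whittaker_torus_unit hd ϖ m u hu, whittaker_torus_pow hψ1 hN hb hϖ1 hU m]
  -- the test pair `(Λ, v)` and `(id, 1)` for the trivial representation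
  set Λ' : Module.Dual ℂ ℂ := LinearMap.id with hΛ'_def
  have hΛ' : Λ' ∈ whittakerFunctionals (Representation.trivial ℂ (GL (Fin 1) F) ℂ) ψ⁻¹ := by
    rw [whittakerFunctionals_eq_top_of_fin_one]; exact Submodule.mem_top
  have hW' : ∀ g, whittakerModel (Representation.trivial ℂ (GL (Fin 1) F) ℂ) Λ' (1 : ℂ) g = 1 := fun g => by
    rw [whittakerModel_trivial_apply]; rfl
  obtain ⟨R, hR, hRe⟩ := hP₀.2.1 Λ hΛ Λ' hΛ' v 1
  -- the zeta integral is the torus integral of `W(d(·, 1))`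
  have hZ : ∀ s : ℂ, rsZeta Nat.one_lt_two ν₀ (whittakerModel π Λ v)
      (whittakerModel (Representation.trivial ℂ (GL (Fin 1) F) ℂ) Λ' 1) s =
      ∫ a, W (diagGL2 a 1) * 1 * (((normAbs F (a : F) : ℝ≥0) : ℝ) : ℂ) ^ (s - 1 / 2) ∂μ' := fun s =>
    rsZeta_eq_integral_torus μ' ν₀ hint _ hW' s
  -- constants: `x = q⁻¹`, `A = μ'(𝒪ˣ) W(1) ≠ 0`
  set x : ℝ := (((residueFieldCard F : ℝ≥0)⁻¹ : ℝ≥0) : ℝ) with hxdef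
  have hx0 : 0 < x := by rw [hxdef]; exact_mod_cast inv_residueFieldCard_pos (F := F)
  have hx1 : x < 1 := by rw [hxdef]; exact_mod_cast inv_residueFieldCard_lt_one (F := F)
  set A : ℂ := (μ' {x : Fˣ | valuation F (x : F) = 1}).toReal * (1 * W 1) with hAdef
  have hA : A ≠ 0 := by
    refine mul_ne_zero ?_ (mul_ne_zero one_ne_zero hW1)
    exact Complex.ofReal_ne_zero.2
      (ENNReal.toReal_pos (measure_unitSphere_pos μ').ne' (measure_unitSphere_lt_top μ').ne).ne'
  -- Step A: `(1 - α q^{-s}) Ψ(s) = A` for `re s` large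
  obtain ⟨N, hN'⟩ : ∃ N : ℕ, ‖c‖ * x ^ N < 1 := by
    have ht : Filter.Tendsto (fun j : ℕ => ‖c‖ * x ^ j) Filter.atTop (nhds 0) := by
      rw [← mul_zero ‖c‖]
      exact (tendsto_pow_atTop_nhds_zero_of_lt_one hx0.le hx1).const_mul _
    obtain ⟨N, hN⟩ := Filter.eventually_atTop.1 (ht.eventually (gt_mem_nhds zero_lt_one))
    exact ⟨N, hN N le_rfl⟩
  have hconst : ∀ s : ℂ, (N : ℝ) + 1 / 2 < s.re →
      (1 - C (c * ς) * X).eval ((q : ℂ) ^ (-s)) *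
        rsZeta Nat.one_lt_two ν₀ (whittakerModel π Λ v)
          (whittakerModel (Representation.trivial ℂ (GL (Fin 1) F) ℂ) Λ' 1) s = A := by
    intro s hs
    have hz : ‖c * (x : ℂ) ^ (s - 1 / 2)‖ < 1 := by
      rw [norm_mul, Complex.norm_cpow_eq_rpow_re_of_pos hx0, Complex.sub_re,
        show ((1 : ℂ) / 2).re = 1 / 2 by norm_num]
      have hle : x ^ (s.re - 1 / 2) ≤ x ^ (N : ℝ) :=
        Real.rpow_le_rpow_of_exponent_ge hx0 hx1.le (by linarith)
      rw [Real.rpow_natCast] at hle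
      exact lt_of_le_of_lt (mul_le_mul_of_nonneg_left hle (norm_nonneg _)) hN'
    have hne : (1 : ℂ) - c * (x : ℂ) ^ (s - 1 / 2) ≠ 0 := by
      intro h
      have : ‖c * (x : ℂ) ^ (s - 1 / 2)‖ = 1 := by rw [← sub_eq_zero.1 h, norm_one]
      exact hz.ne this
    rw [hZ s, integral_torus_whittaker_eq μ' hϖ h0 h1 1 s hz]
    have hxs : (x : ℂ) ^ (s - 1 / 2) = ς * ((q : ℕ) : ℂ) ^ (-s) := by
      rw [hxdef, hς_def, hq_def]
      exact inv_residueFieldCard_cpow_sub_half s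
    simp only [Polynomial.eval_sub, Polynomial.eval_one, Polynomial.eval_mul, Polynomial.eval_C,
      Polynomial.eval_X]
    rw [hxs] at hne
    have hfold : ((((residueFieldCard F : ℝ≥0)⁻¹ : ℝ≥0) : ℝ) : ℂ) ^ (s - 1 / 2) =
        ς * ((q : ℕ) : ℂ) ^ (-s) := by
      rw [← hxs, hxdef]
    rw [hfold, hAdef]
    have hne' : (1 : ℂ) - c * ς * ((q : ℕ) : ℂ) ^ (-s) ≠ 0 := by rwa [mul_assoc]
    field_simp
  refine dvd_of_eval_mul_eq_const hq hP₀.ne_zero ?_ _ hR hRe hA (σ₀ := (N : ℝ) + 1 / 2) hconst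
  simp

end Local

/-! ### The raw new-vector Whittaker datum of a local component (Part C, steps 1–4) -/

section Witness

open _root_.MeasureTheory Matrix.GeneralLinearGroup ValuativeRel
open Literature.NumberTheory.GaloisRepresentations.IsNonarchimedeanLocalField
open IsDedekindDomain.HeightOneSpectrum Rat.HeightOneSpectrum
open scoped NNReal ComplexConjugate

variable {hcpt : isCompact_glFiniteIntegralLevel 2 ℚ}

-- heartbeats, not wall-clock (< 1 min): many `isDefEq` calls against a ~60-hypothesis context
set_option maxHeartbeats 800000 in
/-- **The new-vector Whittaker datum of a local component (clean model).**  Let `π₀` be a cuspidal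
datum of `GL₂(𝔸_ℚ)` with `W' = ⊥`, `c₀ ∈ C` a non-zero `K₁(𝔫)`-fixed `U_w`-eigenvector with
eigenvalue `λ` (`U_w = ∑_{j<ℓ} r(ι_w(ℓ j; 0 1))`), and `π_w` a local component of `π₀` at `w`
(`HasLocalComponentAt`).  Then there are a Whittaker functional `Λ` of `π_w` for the local component
`ψ_w` of Tate's character and a vector `v ∈ π_w` whose Whittaker function `W = 𝒲(Λ)(v)` is right
invariant under `n(t)` (`|t| ≤ 1`) and `d(u, 1)` (`|u| = 1`), satisfies
`∑_{j<ℓ} W(g n(j) d(ℓ, 1)) = λ W(g)` and `W(1) ≠ 0`.  This is Part C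
(`exists_rsZeta_not_laurent_of_newvector_of_bot`, steps 1–4) verbatim, with the datum itself as the
conclusion: the functional `Λ(c) = W_c(g')` at a point with `W_{c₀}(g) ≠ 0`, the local Whittaker
functions `x ↦ Λ(ι_w(x) c)`, and a summand `cᵢ = eᵢ(pᵢ c₀)` of the `π_w`-isotypic decomposition of
`c₀` with `Λ(cᵢ) ≠ 0`.
[cite: JacquetLanglands1970, Prop. 3.5] [cite: JacquetPiatetskiShapiroShalika1983, Thm. 2.7, (2.4)]
[cite: CogdellAnalyticTheory2004, Thm. 1.1, §1.2] -/
theorem exists_newvector_whittakerModel_of_bot (π₀ : CuspidalAutomorphicRepData 2 ℚ hcpt)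
    (hbot : π₀.1.W' = ⊥) {𝔫 : Ideal (𝓞 ℚ)} {w : HeightOneSpectrum (𝓞 ℚ)} (c₀ : π₀.1.Quot) (hc₀ : c₀ ≠ 0)
    (hK : ∀ k (hk : k ∈ gammaOneFiniteLevel ℚ 𝔫), π₀.1.finiteRep ⟨GLn.ofFinite 2 ℚ k, k, rfl⟩ c₀ = c₀)
    {lam : ℂ}
    (hU : ∑ j : Fin (natGenerator w), π₀.1.finiteRep ⟨GLn.ofLocal 2 ℚ w
        (heckeLocalRep (Rat.localUniformizer w : w.adicCompletion ℚ)
          (fun i : Fin (natGenerator w) => algebraMap ℚ (w.adicCompletion ℚ) ((i : ℕ) : ℚ))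
          (Rat.localUniformizer w).ne_zero (some j)), GLn.ofLocal_mem_range_ofFinite w _⟩ c₀ = lam • c₀)
    (πv : SmoothIrrep (GL (Fin 2) (w.adicCompletion ℚ))) (h0 : π₀.1.HasLocalComponentAt w πv.ρ) :
    ∃ Λ ∈ whittakerFunctionals πv.ρ ((adeleAddChar ℚ).adicComponent w), ∃ v : πv.V,
      (∀ t : w.adicCompletion ℚ, normAbs (w.adicCompletion ℚ) t ≤ 1 → ∀ y : GL (Fin 2) (w.adicCompletion ℚ),
        whittakerModel πv.ρ Λ v (y * ((unipotentGL2 t : ↥(upperUnitriangular (Fin 2) (w.adicCompletion ℚ))) :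
          GL (Fin 2) (w.adicCompletion ℚ))) = whittakerModel πv.ρ Λ v y) ∧
      (∀ u : (w.adicCompletion ℚ)ˣ, normAbs (w.adicCompletion ℚ) (u : w.adicCompletion ℚ) = 1 →
        ∀ y : GL (Fin 2) (w.adicCompletion ℚ),
          whittakerModel πv.ρ Λ v (y * diagGL2 u 1) = whittakerModel πv.ρ Λ v y) ∧
      (∀ y : GL (Fin 2) (w.adicCompletion ℚ),
        ∑ j : Fin (natGenerator w), whittakerModel πv.ρ Λ v
          (y * (((unipotentGL2 (algebraMap ℚ (w.adicCompletion ℚ) ((j : ℕ) : ℚ)) :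
              ↥(upperUnitriangular (Fin 2) (w.adicCompletion ℚ))) : GL (Fin 2) (w.adicCompletion ℚ)) *
            diagGL2 (Rat.localUniformizer w) 1)) = lam * whittakerModel πv.ρ Λ v y) ∧
      whittakerModel πv.ρ Λ v 1 ≠ 0 := by
  have hιmem : ∀ t : GL (Fin 2) (w.adicCompletion ℚ), GLn.ofLocal 2 ℚ w t ∈ (AutomorphyDatum.gl 2 ℚ hcpt).finiteAdelic :=
    fun t => GLn.ofLocal_mem_range_ofFinite w t
  -- `C / ⊥ ≅ C`
  have hker : π₀.1.kerQuot = ⊥ := by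
    rw [AutomorphicRepData.kerQuot, hbot, Submodule.comap_bot, Submodule.ker_subtype]
  obtain ⟨e₀, he₀_mk, he₀_symm⟩ : ∃ e₀ : π₀.1.Quot ≃ₗ[ℂ] π₀.1.W,
      (∀ c, e₀ (Submodule.Quotient.mk c) = c) ∧ (∀ c, e₀.symm c = Submodule.Quotient.mk c) :=
    ⟨Submodule.quotEquivOfEqBot _ hker, fun c => Submodule.quotEquivOfEqBot_apply_mk _ _ c,
      fun c => Submodule.quotEquivOfEqBot_symm_apply _ _ c⟩
  have he₀R : ∀ (g : (AutomorphyDatum.gl 2 ℚ hcpt).finiteAdelic) (c : π₀.1.Quot),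
      ((e₀ (π₀.1.finiteRep g c) : π₀.1.W) : (AdelicGroupData.gl 2 ℚ).Adelic → ℂ) =
        rightTranslation (AdelicGroupData.gl 2 ℚ) (g : (AdelicGroupData.gl 2 ℚ).Adelic)
          ((e₀ c : π₀.1.W) : (AdelicGroupData.gl 2 ℚ).Adelic → ℂ) := by
    intro g c
    have hc : c = Submodule.Quotient.mk (e₀ c) := by rw [← he₀_symm, LinearEquiv.symm_apply_apply]
    conv_lhs => rw [hc, AutomorphicRepData.finiteRep_mk, he₀_mk]
  -- the local action `σ = π₀.finiteRep ∘ ι_w` on `C / ⊥`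
  obtain ⟨σ, hσ⟩ : ∃ σ : Representation ℂ (GL (Fin 2) (w.adicCompletion ℚ)) π₀.1.Quot,
      ∀ t c, σ t c = π₀.1.finiteRep ⟨GLn.ofLocal 2 ℚ w t, hιmem t⟩ c := by
    refine ⟨{ toFun := fun t => π₀.1.finiteRep ⟨GLn.ofLocal 2 ℚ w t, hιmem t⟩
              map_one' := ?_
              map_mul' := fun t t' => ?_ }, fun t c => rfl⟩
    · have h1 : (⟨GLn.ofLocal 2 ℚ w 1, hιmem 1⟩ : (AutomorphyDatum.gl 2 ℚ hcpt).finiteAdelic) = 1 :=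
        Subtype.ext (map_one _)
      rw [h1, map_one]
    · have h2 : (⟨GLn.ofLocal 2 ℚ w (t * t'), hιmem (t * t')⟩ : (AutomorphyDatum.gl 2 ℚ hcpt).finiteAdelic) =
          ⟨GLn.ofLocal 2 ℚ w t, hιmem t⟩ * ⟨GLn.ofLocal 2 ℚ w t', hιmem t'⟩ :=
        Subtype.ext (map_mul _ _ _)
      rw [h2, map_mul]
  -- notation: `ψ_w`, `ϖ`, `b`, the representatives `y_j = (ϖ b_j; 0 1) = n(b_j) d(ϖ, 1)`
  obtain ⟨ψw, hψw_def⟩ : ∃ ψw : AddChar (w.adicCompletion ℚ) Circle, ψw = (adeleAddChar ℚ).adicComponent w :=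
    ⟨_, rfl⟩
  obtain ⟨ϖ, hϖ_def⟩ : ∃ ϖ : (w.adicCompletion ℚ)ˣ, ϖ = Rat.localUniformizer w := ⟨_, rfl⟩
  obtain ⟨b, hb_def⟩ : ∃ b : Fin (natGenerator w) → w.adicCompletion ℚ,
      b = fun i : Fin (natGenerator w) => algebraMap ℚ (w.adicCompletion ℚ) ((i : ℕ) : ℚ) := ⟨_, rfl⟩
  have hU₀ : ∑ j, σ (heckeLocalRep (ϖ : w.adicCompletion ℚ) b ϖ.ne_zero (some j)) c₀ = lam • c₀ := by
    subst hϖ_def hb_def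
    simp_rw [hσ]
    exact hU
  clear hU
  have hyrep : ∀ j : Fin (natGenerator w), heckeLocalRep (ϖ : w.adicCompletion ℚ) b ϖ.ne_zero (some j) =
      ((unipotentGL2 (b j) : ↥(upperUnitriangular (Fin 2) (w.adicCompletion ℚ))) :
        GL (Fin 2) (w.adicCompletion ℚ)) * diagGL2 ϖ 1 := fun j => by
    rw [hϖ_def, hb_def]
    exact heckeLocalRep_some_eq_unipotentGL2_mul_diagGL2 j
  haveI : Nonempty (Fin (natGenerator w)) := ⟨⟨0, (prime_natGenerator w).pos⟩⟩
  haveI := πv.isIrreducible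
  have hψ : ψw.HasConductorExp 0 := hψw_def ▸ hasConductorExp_zero_adicComponent_adeleAddChar_rat w
  have hψw : ψw.IsContinuousNontrivial := hψw_def ▸
    (isGlobalAddChar_adeleAddChar ℚ).isContinuousNontrivial_adicComponent (adicComponent_adeleAddChar_ne_one w)
  have hgen : IsGeneric πv.ρ ψw := hψw_def ▸ π₀.isGeneric_of_hasLocalComponentAt w πv.ρ πv.isSmooth h0
  have hb : ∀ i, normAbs (w.adicCompletion ℚ) (b i) ≤ 1 := fun i => by
    rw [hb_def]
    exact normAbs_algebraMap_natCast_le_one w i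
  have hϖ : normAbs (w.adicCompletion ℚ) (ϖ : w.adicCompletion ℚ) =
      (residueFieldCard (w.adicCompletion ℚ) : ℝ≥0)⁻¹ := by
    rw [hϖ_def]
    exact normAbs_localUniformizer w
  -- the cusp form `φ₀ ∈ C` representing `c₀`
  obtain ⟨φ₀, hφ₀_def⟩ : ∃ φ₀ : (AdelicGroupData.gl 2 ℚ).Adelic → ℂ,
      φ₀ = ((e₀ c₀ : π₀.1.W) : (AdelicGroupData.gl 2 ℚ).Adelic → ℂ) := ⟨_, rfl⟩
  have hφ₀W : φ₀ ∈ π₀.1.W := hφ₀_def ▸ (e₀ c₀).2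
  have hφ₀0 : φ₀ ≠ 0 := by
    intro h
    have : (e₀ c₀ : π₀.1.W) = 0 := Subtype.ext (hφ₀_def ▸ h)
    exact hc₀ ((LinearEquiv.map_eq_zero_iff e₀).mp this)
  have hcf₀ : IsCuspFormGL 2 ℚ hcpt φ₀ := isCuspFormGL_of_mem_cuspFormsGL' (π₀.2 hφ₀W)
  -- `K₁(𝔫)`-invariance of `c₀` (global and local forms)
  have hKφ₀ : ∀ k ∈ gammaOneFiniteLevel ℚ 𝔫,
      rightTranslation (AdelicGroupData.gl 2 ℚ) (GLn.ofFinite 2 ℚ k) φ₀ = φ₀ := by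
    have h : ∀ g : (AutomorphyDatum.gl 2 ℚ hcpt).finiteAdelic, π₀.1.finiteRep g c₀ = c₀ →
        rightTranslation (AdelicGroupData.gl 2 ℚ) (g : (AdelicGroupData.gl 2 ℚ).Adelic) φ₀ = φ₀ := by
      intro g hg
      have h2 := he₀R g c₀
      rw [hg, ← hφ₀_def] at h2
      exact h2.symm
    intro k hk
    have h3 := h _ (hK k hk)
    exact h3
  have hK₀ : ∀ mm ∈ Rat.localGammaOne w 𝔫, σ mm c₀ = c₀ := by
    intro mm hmm
    have hk : GLn.sndHom 2 ℚ (GLn.ofLocal 2 ℚ w mm) ∈ gammaOneFiniteLevel ℚ 𝔫 :=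
      Rat.mem_localGammaOne_iff'.1 hmm
    have h' := hK _ hk
    rw [hσ]
    convert h' using 3
    exact Subtype.ext (ofFinite_sndHom_ofLocal w mm).symm
  -- Step 2: the Whittaker datum and a non-vanishing torus coefficient of `φ₀`
  letI : MeasurableSpace ↥(adelicUnipotent 2 ℚ) := borel _
  haveI : BorelSpace ↥(adelicUnipotent 2 ℚ) := ⟨rfl⟩
  obtain ⟨ν₀, hν₀, hν₀R, hν₀S, h𝓕, h𝓕m, h𝓕c, -, -⟩ := exists_isHaarMeasure_isFundamentalDomain_adelicUnipotent 2 ℚ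
  haveI := hν₀
  haveI := hν₀R
  haveI := hν₀S
  obtain ⟨hinf, yf, hne⟩ := exists_whittakerCoeff_torus_ne_zero h𝓕 h𝓕m hcf₀ hφ₀0 hKφ₀
  obtain ⟨g, hg_def⟩ : ∃ g : GL (Fin 2) (AdeleRing (𝓞 ℚ) ℚ),
      g = Rat.ofRealGL 2 hinf * GLn.ofFinite 2 ℚ (diagGL2 yf 1) := ⟨_, rfl⟩
  rw [← hg_def] at hne
  obtain ⟨yw, hyw_def⟩ : ∃ yw : (w.adicCompletion ℚ)ˣ,
      yw = Units.map (AdelicGroupData.finiteAdeleEval ℚ w : FiniteAdeleRing (𝓞 ℚ) ℚ →* w.adicCompletion ℚ) yf :=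
    ⟨_, rfl⟩
  have ht : GLn.localPart 2 ℚ w g = diagGL2 yw 1 := by
    rw [hg_def, hyw_def]
    exact localPart_ofRealGL_mul_ofFinite_diagGL2 w hinf yf
  obtain ⟨g', hg'_def⟩ : ∃ g' : GL (Fin 2) (AdeleRing (𝓞 ℚ) ℚ), g' = g * (GLn.ofLocal 2 ℚ w (diagGL2 yw 1))⁻¹ :=
    ⟨_, rfl⟩
  have hg' : Matrix.GeneralLinearGroup.map (AdelicGroupData.adeleEval ℚ w) g' = 1 := by
    change GLn.localPart 2 ℚ w g' = 1
    rw [hg'_def, map_mul, map_inv, GLn.localPart_ofLocal, ht, mul_inv_cancel]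
  have hgg' : GLn.ofLocal 2 ℚ w (diagGL2 yw 1) * g' = g := by
    rw [GLn.ofLocal_mul_eq_mul_ofLocal_of_toLocal_eq_one _ hg', hg'_def, inv_mul_cancel_right]
  -- forms of `C` are continuous cusp forms, left `GL₂(ℚ)`-invariant; Whittaker integrands integrable
  have hcont : ∀ c : π₀.1.W, Continuous ((c : π₀.1.W) : (AdelicGroupData.gl 2 ℚ).Adelic → ℂ) := fun c =>
    (isCuspFormGL_of_mem_cuspFormsGL' (π₀.2 c.2)).1.continuous_gl
  have hleft : ∀ c : π₀.1.W, IsLeftInvariant (AdelicGroupData.gl 2 ℚ) ((c : π₀.1.W) : (AdelicGroupData.gl 2 ℚ).Adelic → ℂ) :=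
    fun c => (isCuspFormGL_of_mem_cuspFormsGL' (π₀.2 c.2)).1.leftInvariant
  have hint : ∀ (c : π₀.1.W) (x : GL (Fin 2) (AdeleRing (𝓞 ℚ) ℚ)), IntegrableOn (fun u : ↥(adelicUnipotent 2 ℚ) =>
      ((c : π₀.1.W) : (AdelicGroupData.gl 2 ℚ).Adelic → ℂ) ((u : GL (Fin 2) (AdeleRing (𝓞 ℚ) ℚ)) * x) *
        conj (whittakerCharFun (adeleAddChar ℚ) u)) (unipotentTateDomain 2 ℚ) ν₀ := fun c x =>
    integrableOn_whittakerIntegrand_of_continuous h𝓕c (isGlobalAddChar_adeleAddChar ℚ).continuous (hcont c) x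
  -- Step 3: the functional `Λ(c) = W_{e₀ c}(g')`
  obtain ⟨Λ, hΛ⟩ : ∃ Λ : π₀.1.Quot →ₗ[ℂ] ℂ, ∀ c, Λ c = whittakerCoeff ν₀ (unipotentTateDomain 2 ℚ) (adeleAddChar ℚ)
      ((e₀ c : π₀.1.W) : (AdelicGroupData.gl 2 ℚ).Adelic → ℂ) g' := by
    refine ⟨{ toFun := fun c => whittakerCoeff ν₀ (unipotentTateDomain 2 ℚ) (adeleAddChar ℚ)
                ((e₀ c : π₀.1.W) : (AdelicGroupData.gl 2 ℚ).Adelic → ℂ) g'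
              map_add' := fun c c' => ?_
              map_smul' := fun a c => ?_ }, fun c => rfl⟩
    · simp only [map_add, Submodule.coe_add]
      exact whittakerCoeff_add ν₀ (unipotentTateDomain 2 ℚ) (adeleAddChar ℚ) g' (hint _ _) (hint _ _)
    · simp only [map_smul, Submodule.coe_smul, RingHom.id_apply]
      exact whittakerCoeff_const_smul ν₀ (unipotentTateDomain 2 ℚ) (adeleAddChar ℚ) a _ g'
  -- the local Whittaker functions `x ↦ Λ(σ(x) c) = W_{e₀ c}(ι_w(x) g')`
  have hW : ∀ (c : π₀.1.Quot) (x : GL (Fin 2) (w.adicCompletion ℚ)),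
      Λ (σ x c) = whittakerCoeff ν₀ (unipotentTateDomain 2 ℚ) (adeleAddChar ℚ)
        ((e₀ c : π₀.1.W) : (AdelicGroupData.gl 2 ℚ).Adelic → ℂ) (GLn.ofLocal 2 ℚ w x * g') := by
    intro c x
    have h := whittakerCoeff_ofLocal_mul_right (ν := ν₀) (𝓕 := unipotentTateDomain 2 ℚ) hg'
      ((e₀ c : π₀.1.W) : (AdelicGroupData.gl 2 ℚ).Adelic → ℂ) 1 x
    rw [one_mul, map_one, one_mul] at h
    rw [h, hΛ, hσ, he₀R]
  -- (N, ψ_w)-equivariance of every `W_c`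
  have hN_of : ∀ (c : π₀.1.Quot) (x : w.adicCompletion ℚ) (y : GL (Fin 2) (w.adicCompletion ℚ)),
      Λ (σ (((unipotentGL2 x : ↥(upperUnitriangular (Fin 2) (w.adicCompletion ℚ))) :
        GL (Fin 2) (w.adicCompletion ℚ)) * y) c) = ψw x * Λ (σ y c) := by
    intro c x y
    rw [hW, hW, hψw_def]
    exact whittakerCoeff_ofLocal_unipotent_mul h𝓕 (hleft (e₀ c)) g' x y
  -- right invariances and the `U`-identity of `W_c`, for `K₁(𝔫)_w`-fixed `U_w`-eigenvectors `c`
  have hn_of : ∀ c : π₀.1.Quot, (∀ mm ∈ Rat.localGammaOne w 𝔫, σ mm c = c) →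
      ∀ t : w.adicCompletion ℚ, normAbs (w.adicCompletion ℚ) t ≤ 1 → ∀ y : GL (Fin 2) (w.adicCompletion ℚ),
        Λ (σ (y * ((unipotentGL2 t : ↥(upperUnitriangular (Fin 2) (w.adicCompletion ℚ))) :
          GL (Fin 2) (w.adicCompletion ℚ))) c) = Λ (σ y c) := by
    intro c hcK t htn y
    have hu : ((unipotentGL2 t : ↥(upperUnitriangular (Fin 2) (w.adicCompletion ℚ))) :
        GL (Fin 2) (w.adicCompletion ℚ)) = upperRightHom t := rfl
    rw [map_mul, Module.End.mul_apply, hu,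
      hcK _ (upperRightHom_mem_localGammaOne (normAbs_le_one_iff_valued.1 htn))]
  have hd_of : ∀ c : π₀.1.Quot, (∀ mm ∈ Rat.localGammaOne w 𝔫, σ mm c = c) →
      ∀ u : (w.adicCompletion ℚ)ˣ, normAbs (w.adicCompletion ℚ) (u : w.adicCompletion ℚ) = 1 →
        ∀ y : GL (Fin 2) (w.adicCompletion ℚ), Λ (σ (y * diagGL2 u 1) c) = Λ (σ y c) := by
    intro c hcK u hu y
    rw [map_mul, Module.End.mul_apply, hcK _ (diagGL2_mem_localGammaOne (valued_eq_one_of_normAbs_eq_one hu))]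
  have hU_of : ∀ c : π₀.1.Quot, (∑ j, σ (heckeLocalRep (ϖ : w.adicCompletion ℚ) b ϖ.ne_zero (some j)) c = lam • c) →
      ∀ y : GL (Fin 2) (w.adicCompletion ℚ),
      ∑ j, Λ (σ (y * (((unipotentGL2 (b j) : ↥(upperUnitriangular (Fin 2) (w.adicCompletion ℚ))) :
        GL (Fin 2) (w.adicCompletion ℚ)) * diagGL2 ϖ 1)) c) = lam * Λ (σ y c) := by
    intro c hcU y
    simp_rw [← hyrep, map_mul, Module.End.mul_apply]
    rw [← map_sum, ← map_sum, hcU, map_smul, map_smul, smul_eq_mul]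
  -- `Λ(c₀) ≠ 0`: `W_{c₀}(d(y_w, 1)) = W_{φ₀}(g) ≠ 0`
  have hΛc₀ : Λ c₀ ≠ 0 := by
    have h1 : Λ (σ (diagGL2 yw 1) c₀) ≠ 0 := by
      rw [hW, hgg', ← hφ₀_def]
      exact hne
    have h2 := whittaker_one_ne_zero_of_torus_ne_zero (W := fun x => Λ (σ x c₀)) hψ (hN_of c₀) (hn_of c₀ hK₀)
      (hd_of c₀ hK₀) hb hϖ (hU_of c₀ hU₀) h1
    simpa only [map_one, Module.End.one_apply] using h2
  -- Step 4: the isotypic decomposition `c₀ = ∑ᵢ eᵢ (pᵢ c₀)` along `π_w`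
  obtain ⟨m, e, p, he, hp, hsum⟩ := exists_sum_intertwining_of_hasLocalComponentAt π₀.1 w πv.ρ h0 c₀
  have he' : ∀ i (t : GL (Fin 2) (w.adicCompletion ℚ)) (x : πv.V), e i (πv.ρ t x) = σ t (e i x) :=
    fun i t x => by rw [hσ]; exact he i t x
  have hp' : ∀ i (t : GL (Fin 2) (w.adicCompletion ℚ)) (q : π₀.1.Quot), p i (σ t q) = πv.ρ t (p i q) :=
    fun i t q => by rw [hσ]; exact hp i t q
  have hsumΛ : ∑ i, Λ (e i (p i c₀)) ≠ 0 := by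
    rwa [← map_sum, ← hsum]
  obtain ⟨i, -, hi⟩ := Finset.exists_ne_zero_of_sum_ne_zero hsumΛ
  obtain ⟨cᵢ, hcᵢ_def⟩ : ∃ cᵢ : π₀.1.Quot, cᵢ = e i (p i c₀) := ⟨_, rfl⟩
  have hσcᵢ : ∀ t, σ t cᵢ = e i (p i (σ t c₀)) := fun t => by
    rw [hcᵢ_def, ← he', ← hp']
  have hKᵢ : ∀ mm ∈ Rat.localGammaOne w 𝔫, σ mm cᵢ = cᵢ := fun mm hmm => by
    rw [hσcᵢ, hK₀ mm hmm, hcᵢ_def]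
  have hUᵢ : ∑ j, σ (heckeLocalRep (ϖ : w.adicCompletion ℚ) b ϖ.ne_zero (some j)) cᵢ = lam • cᵢ := by
    simp_rw [hσcᵢ]
    rw [← map_sum, ← map_sum, hU₀, map_smul, map_smul, hcᵢ_def]
  -- the Whittaker functional `Λ ∘ eᵢ` on `π_w` and its Whittaker function at `pᵢ c₀`
  obtain ⟨Λᵢ, hΛᵢ_def⟩ : ∃ Λᵢ : πv.V →ₗ[ℂ] ℂ, Λᵢ = Λ.comp (e i) := ⟨_, rfl⟩
  have hΛᵢ_apply : ∀ x, Λᵢ x = Λ (e i x) := fun x => by rw [hΛᵢ_def]; rfl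
  have hΛᵢ : Λᵢ ∈ whittakerFunctionals πv.ρ ψw := by
    refine (mem_whittakerFunctionals_iff _).2 fun u x => ?_
    rw [hΛᵢ_apply, hΛᵢ_apply, he', ← unipotentGL2_entry u, whittakerCharFun_fin_two, unipotentGL2_apply_zero_one,
      ← mul_one (((unipotentGL2 _ : ↥(upperUnitriangular (Fin 2) (w.adicCompletion ℚ))) :
        GL (Fin 2) (w.adicCompletion ℚ))), hN_of, map_one, Module.End.one_apply]
  have hWfun : whittakerModel πv.ρ Λᵢ (p i c₀) = fun t => Λ (σ t cᵢ) := by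
    funext t
    rw [whittakerModel_apply, hσcᵢ, hp', hΛᵢ_apply]
  have hW1 : (fun t => Λ (σ t cᵢ)) 1 ≠ 0 := by
    simpa only [map_one, Module.End.one_apply, hcᵢ_def] using hi

  -- the datum `(Λᵢ, pᵢ c₀)`
  refine ⟨Λᵢ, hψw_def ▸ hΛᵢ, p i c₀, ?_, ?_, ?_, ?_⟩
  · intro t ht y
    rw [hWfun]
    exact hn_of cᵢ hKᵢ t ht y
  · intro u hu y
    rw [hWfun]
    exact hd_of cᵢ hKᵢ u hu y
  · intro y
    rw [hWfun]
    have h := hU_of cᵢ hUᵢ y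
    rw [hϖ_def, hb_def] at h
    exact h
  · rw [hWfun]
    exact hW1

/-- **The new-vector Whittaker datum of a local component.**  As
`exists_newvector_whittakerModel_of_bot`, for an arbitrary cuspidal datum `π` of `GL₂(𝔸_ℚ)` with a
non-zero `K₁(𝔫)`-fixed `U_w`-eigenvector `q₀ ∈ W / W'` of eigenvalue `λ`: pass to a clean model
`C / ⊥ ≅ W / W'` (`exists_cleanModel_newvector`; local components are preserved).
[cite: BorelJacquetCorvallis1979, §4.6 and 5.7] [cite: JacquetLanglands1970, Prop. 3.5] -/
theorem exists_newvector_whittakerModel (π : CuspidalAutomorphicRepData 2 ℚ hcpt)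
    {𝔫 : Ideal (𝓞 ℚ)} {w : HeightOneSpectrum (𝓞 ℚ)} (q₀ : π.1.Quot) (hq₀ : q₀ ≠ 0)
    (hK : ∀ k (hk : k ∈ gammaOneFiniteLevel ℚ 𝔫), π.1.finiteRep ⟨GLn.ofFinite 2 ℚ k, k, rfl⟩ q₀ = q₀)
    {lam : ℂ}
    (hU : ∑ j : Fin (natGenerator w), π.1.finiteRep ⟨GLn.ofLocal 2 ℚ w
        (heckeLocalRep (Rat.localUniformizer w : w.adicCompletion ℚ)
          (fun i : Fin (natGenerator w) => algebraMap ℚ (w.adicCompletion ℚ) ((i : ℕ) : ℚ))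
          (Rat.localUniformizer w).ne_zero (some j)), GLn.ofLocal_mem_range_ofFinite w _⟩ q₀ = lam • q₀)
    (πv : SmoothIrrep (GL (Fin 2) (w.adicCompletion ℚ))) (hπv : π.1.HasLocalComponentAt w πv.ρ) :
    ∃ Λ ∈ whittakerFunctionals πv.ρ ((adeleAddChar ℚ).adicComponent w), ∃ v : πv.V,
      (∀ t : w.adicCompletion ℚ, normAbs (w.adicCompletion ℚ) t ≤ 1 → ∀ y : GL (Fin 2) (w.adicCompletion ℚ),
        whittakerModel πv.ρ Λ v (y * ((unipotentGL2 t : ↥(upperUnitriangular (Fin 2) (w.adicCompletion ℚ))) :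
          GL (Fin 2) (w.adicCompletion ℚ))) = whittakerModel πv.ρ Λ v y) ∧
      (∀ u : (w.adicCompletion ℚ)ˣ, normAbs (w.adicCompletion ℚ) (u : w.adicCompletion ℚ) = 1 →
        ∀ y : GL (Fin 2) (w.adicCompletion ℚ),
          whittakerModel πv.ρ Λ v (y * diagGL2 u 1) = whittakerModel πv.ρ Λ v y) ∧
      (∀ y : GL (Fin 2) (w.adicCompletion ℚ),
        ∑ j : Fin (natGenerator w), whittakerModel πv.ρ Λ v
          (y * (((unipotentGL2 (algebraMap ℚ (w.adicCompletion ℚ) ((j : ℕ) : ℚ)) :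
              ↥(upperUnitriangular (Fin 2) (w.adicCompletion ℚ))) : GL (Fin 2) (w.adicCompletion ℚ)) *
            diagGL2 (Rat.localUniformizer w) 1)) = lam * whittakerModel πv.ρ Λ v y) ∧
      whittakerModel πv.ρ Λ v 1 ≠ 0 := by
  obtain ⟨π₀, c₀, hbot, h0, hc₀, hK₀, hU₀⟩ := exists_cleanModel_newvector π q₀ hq₀ hK hU hπv
  exact exists_newvector_whittakerModel_of_bot π₀ hbot c₀ hc₀ hK₀ hU₀ πv h0

/-- **The pole of the new vector divides every JPSS `L`-polynomial of a local component.**  Let `π`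
be a cuspidal datum of `GL₂(𝔸_ℚ)` with a non-zero `K₁(𝔫)`-fixed `U_w`-eigenvector of eigenvalue `λ`
(`U_w = ∑_{j<ℓ} r(ι_w(ℓ j; 0 1))`, `ℓ` the prime of `w`) and `π_w` a local component of `π` at `w`.
Then for every `GL₁(ℚ_w)`-invariant Radon measure `ν` of full support on `GL₁(ℚ_w) ⧸ U₁` and every
`P` with `HasRSLFactor (1<2) π_w 𝟙 ψ_w ν P` (`ψ_w` the local component of Tate's character):
`(1 - (λ/ℓ) √ℓ · X) ∣ P` — classically `L(s, π_w) ⊇ (1 - μ₁(ϖ) ℓ^{-s})⁻¹` for the local component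
`π(μ₁, μ₂)`, `μ₁` unramified, of a newform with `a_ℓ ≠ 0` (Jacquet–Langlands 1970, Prop. 3.5;
Casselman 1973, Thm. 1), obtained here without the local new-vector theory
(`exists_newvector_whittakerModel`, `one_sub_C_mul_X_dvd_of_hasRSLFactor_of_newvector`).
[cite: JacquetLanglands1970, Prop. 3.5] [cite: JacquetPiatetskiShapiroShalika1983, Thm. 2.7 (ii)]
[cite: Casselman1973, Thm. 1] -/
theorem one_sub_C_mul_X_dvd_of_hasRSLFactor_of_localComponent (π : CuspidalAutomorphicRepData 2 ℚ hcpt)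
    {𝔫 : Ideal (𝓞 ℚ)} {w : HeightOneSpectrum (𝓞 ℚ)} (q₀ : π.1.Quot) (hq₀ : q₀ ≠ 0)
    (hK : ∀ k (hk : k ∈ gammaOneFiniteLevel ℚ 𝔫), π.1.finiteRep ⟨GLn.ofFinite 2 ℚ k, k, rfl⟩ q₀ = q₀)
    {lam : ℂ}
    (hU : ∑ j : Fin (natGenerator w), π.1.finiteRep ⟨GLn.ofLocal 2 ℚ w
        (heckeLocalRep (Rat.localUniformizer w : w.adicCompletion ℚ)
          (fun i : Fin (natGenerator w) => algebraMap ℚ (w.adicCompletion ℚ) ((i : ℕ) : ℚ))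
          (Rat.localUniformizer w).ne_zero (some j)), GLn.ofLocal_mem_range_ofFinite w _⟩ q₀ = lam • q₀)
    (πv : SmoothIrrep (GL (Fin 2) (w.adicCompletion ℚ))) (hπv : π.1.HasLocalComponentAt w πv.ρ)
    [MeasurableSpace (GL (Fin 1) (w.adicCompletion ℚ) ⧸ upperUnitriangular (Fin 1) (w.adicCompletion ℚ))]
    [BorelSpace (GL (Fin 1) (w.adicCompletion ℚ) ⧸ upperUnitriangular (Fin 1) (w.adicCompletion ℚ))]
    (ν : Measure (GL (Fin 1) (w.adicCompletion ℚ) ⧸ upperUnitriangular (Fin 1) (w.adicCompletion ℚ)))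
    [SMulInvariantMeasure (GL (Fin 1) (w.adicCompletion ℚ))
      (GL (Fin 1) (w.adicCompletion ℚ) ⧸ upperUnitriangular (Fin 1) (w.adicCompletion ℚ)) ν]
    [IsFiniteMeasureOnCompacts ν] [ν.IsOpenPosMeasure] {P : ℂ[X]}
    (hP : HasRSLFactor Nat.one_lt_two πv.ρ
      (Representation.trivial ℂ (GL (Fin 1) (w.adicCompletion ℚ)) ℂ) ((adeleAddChar ℚ).adicComponent w) ν P) :
    (1 - C (lam / natGenerator w * ((Real.sqrt (natGenerator w) : ℝ) : ℂ)) * X) ∣ P := by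
  obtain ⟨Λ, hΛ, v, hn, hd, hUv, hW1⟩ := exists_newvector_whittakerModel π q₀ hq₀ hK hU πv hπv
  haveI : Nonempty (Fin (natGenerator w)) := ⟨⟨0, (prime_natGenerator w).pos⟩⟩
  have hψ : ((adeleAddChar ℚ).adicComponent w).HasConductorExp 0 :=
    hasConductorExp_zero_adicComponent_adeleAddChar_rat w
  have hb : ∀ i : Fin (natGenerator w),
      normAbs (w.adicCompletion ℚ) (algebraMap ℚ (w.adicCompletion ℚ) ((i : ℕ) : ℚ)) ≤ 1 := fun i =>
    normAbs_algebraMap_natCast_le_one w i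
  have hϖ : normAbs (w.adicCompletion ℚ) ((Rat.localUniformizer w : (w.adicCompletion ℚ)ˣ) : w.adicCompletion ℚ) =
      (residueFieldCard (w.adicCompletion ℚ) : ℝ≥0)⁻¹ := normAbs_localUniformizer w
  have h := one_sub_C_mul_X_dvd_of_hasRSLFactor_of_newvector πv.ρ hψ hΛ v hn hd hb hϖ hUv hW1 ν hP
  rwa [Fintype.card_fin, residueFieldCard_adicCompletion_eq,
    GaloisRepresentations.Rat.residueCard_eq_natGenerator] at h

end Witness

end Literature.NumberTheory.EllipticCurves.Hida2000Thm326

end
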